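import Literature.NumberTheory.GaloisRepresentations.LiftingObstructionParabolic
import HarnessLib

/-!
# Mazur's obstruction class with transported coefficients

Topic `Literature/NumberTheory/GaloisRepresentations`.  Continuation of
`LiftingObstructionContinuous.lean` / `LiftingObstructionParabolic.lean`.  There the obstruction
class of a `P_b(A)`-valued `ρ : G → GL_n(A)` along `φ : B ↠ A` (square-zero kernel `I`) lives in
`H²_cont(G, 𝔭_b(I))` with `𝔭_b(I)` regarded as a `ℤ`-linear representation.  For the relation
count one needs the class in the cohomology of a FIXED coefficient representation `Y` over the
residue field (`Y = ad ρ̄` for a constant pattern, `Y = 𝔟 ⊆ ad ρ̄` for the Borel pattern), along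
an additive `G`-equivariant map `e : 𝔭_b(I) → Y` — in the application `𝔭_b(I) = 𝔭_b ⊗ I → 𝔭_b`
is induced by a functional on `I`, and these maps depend LINEARLY on the functional, which is
what makes Mazur's obstruction map `u ↦ o_u` linear ([Maz89, §1.6 Prop. 2]; [Böc07, (1)]):

* `IsConjEquivariant` — equivariance of `e` for the conjugation action `conjKerParabolic`;
* `coeffMap e`, `defectCocycleIn e` — the continuous `2`-cocycle `e ∘ c` of `G` with values in
  the discrete representation `Y` (`c(σ, τ) = s(ρσ) s(ρτ) s(ρ(στ))⁻¹ − 1`), ADDITIVE and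
  homogeneous in `e` (`defectCocycleIn_add`, `defectCocycleIn_smul`), and the class
  `obstructionClassIn e = [e ∘ c] ∈ H²_cont(G, Y)` (`obstructionClassIn_add/_smul`);
* `obstructionClassIn_eq_zero_iff` — if `e` is BIJECTIVE (an identification of coefficients),
  `[e ∘ c] = 0` iff `ρ` lifts to a `P_b(B)`-valued homomorphism `G → GL_n(B)` with open kernel.

The pattern `b` is arbitrary: a constant pattern gives `P_b = GL_n`, `𝔭_b(I) = M_n(I)`
(`blockTriangular_const`; the unrestricted global problem), `b = id` on `Fin 2` the Borel case
(the nearly ordinary local problem).  Everything is proved; no named facts.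

## References

* B. Mazur, *Deforming Galois representations*, MSRI Publ. 16 (1989), §1.6 Prop. 2, §1.7.
  [cite: Mazur1989Deforming, §1.6 Prop. 2]
* G. Böckle, *Presentations of universal deformation rings*, LMS LNS 320 (2007), Thm. 2.2 and
  (1). [cite: Bockle2007Presentations, Theorem 2.2]
-/

noncomputable section

open Topology Filter

namespace Literature.NumberTheory.GaloisRepresentations

namespace LiftingObstruction

open Matrix

universe u v

/-! ## 0. Constant patterns -/

/-- For a constant pattern every matrix is block-triangular (so `P_b = GL_n`, `𝔭_b(I) = M_n(I)`).
[folklore] -/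
theorem blockTriangular_const {m S β : Type*} [Zero S] [Preorder β] (M : Matrix m m S) (a : β) :
    M.BlockTriangular (fun _ : m => a) :=
  fun _ _ h => (lt_irrefl a h).elim

section Coefficients

variable {n : Type} [Fintype n] [DecidableEq n] {α : Type} [LinearOrder α] (b : n → α)
  {A B : Type v} [CommRing A] [CommRing B] {φ : B →+* A}
  (hI : ∀ x ∈ RingHom.ker φ, ∀ y ∈ RingHom.ker φ, x * y = 0)
  {s : GL n A → GL n B} (hs : ∀ g, Matrix.GeneralLinearGroup.map φ (s g) = g)
  (hsP : ∀ g ∈ parabolicGL b A, s g ∈ parabolicGL b B)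
  {G : Type v} [Group G] [TopologicalSpace G] [IsTopologicalGroup G]
  (ρ : G →* GL n A) (hρP : ∀ σ, ρ σ ∈ parabolicGL b A)
  (hρ : IsOpen ((ρ.ker : Subgroup G) : Set G))
  {R : Type u} [CommRing R] [TopologicalSpace R] (Y : TopRep.{v} R G)

/-! ## 1. Equivariant coefficient maps -/

/-- An additive map `e : 𝔭_b(I) → Y` is **equivariant** for the conjugation action through
`s ∘ ρ` on `𝔭_b(I)` (`conjKerParabolic`) and the action of `G` on `Y`. [folklore] -/
def IsConjEquivariant (e : kerParabolic b φ →+ Y) : Prop :=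
  ∀ (σ : G) (X : kerParabolic b φ), e (conjKerParabolic b hsP ρ hρP σ X) = Y.ρ σ (e X)

include hI hs hsP hρP in
omit [TopologicalSpace G] [IsTopologicalGroup G] in
/-- The cocycle identity of the defect, in `𝔭_b(I)`. [cite: Mazur1989Deforming, §1.6 Prop. 2] -/
theorem conjKerParabolic_defect_add (σ τ υ : G) :
    conjKerParabolic b hsP ρ hρP σ
        ⟨liftDefect s ρ τ υ, liftDefect_mem_kerParabolic b hs hsP ρ hρP τ υ⟩ +
        ⟨liftDefect s ρ σ (τ * υ), liftDefect_mem_kerParabolic b hs hsP ρ hρP σ (τ * υ)⟩ =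
      (⟨liftDefect s ρ (σ * τ) υ, liftDefect_mem_kerParabolic b hs hsP ρ hρP (σ * τ) υ⟩ :
          kerParabolic b φ) +
        ⟨liftDefect s ρ σ τ, liftDefect_mem_kerParabolic b hs hsP ρ hρP σ τ⟩ :=
  Subtype.ext (liftDefect_cocycle hs hI ρ σ τ υ)

variable {b hsP ρ hρP Y}

omit [TopologicalSpace G] [IsTopologicalGroup G] in
/-- Sums of equivariant maps are equivariant. [folklore] -/
theorem IsConjEquivariant.add {e e' : kerParabolic b φ →+ Y}
    (he : IsConjEquivariant b hsP ρ hρP Y e) (he' : IsConjEquivariant b hsP ρ hρP Y e') :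
    IsConjEquivariant b hsP ρ hρP Y (e + e') := fun σ X => by
  simp only [AddMonoidHom.add_apply, he σ X, he' σ X, map_add]

omit [TopologicalSpace G] [IsTopologicalGroup G] in
/-- The zero map is equivariant. [folklore] -/
theorem IsConjEquivariant.zero :
    IsConjEquivariant b hsP ρ hρP Y (0 : kerParabolic b φ →+ Y) :=
  fun σ X => by simp

omit [TopologicalSpace G] [IsTopologicalGroup G] in
/-- Scalar multiples of equivariant maps are equivariant. [folklore] -/
theorem IsConjEquivariant.smul {e : kerParabolic b φ →+ Y}
    (he : IsConjEquivariant b hsP ρ hρP Y e) (r : R) :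
    IsConjEquivariant b hsP ρ hρP Y (r • e) := fun σ X => by
  simp only [AddMonoidHom.smul_apply, he σ X, map_smul]

/-! ## 2. The defect cocycle with values in `Y` -/

open scoped Classical in
/-- Extension by zero of `e : 𝔭_b(I) → Y` to all matrices (a device to compose with cochains).
[folklore] -/
def coeffMap (e : kerParabolic b φ →+ Y) (M : Matrix n n B) : Y :=
  if h : M ∈ kerParabolic b φ then e ⟨M, h⟩ else 0

omit [TopologicalSpace G] [IsTopologicalGroup G] in
/-- `coeffMap e M = e ⟨M, _⟩` on `𝔭_b(I)`. [folklore] -/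
theorem coeffMap_apply_of_mem (e : kerParabolic b φ →+ Y) {M : Matrix n n B}
    (hM : M ∈ kerParabolic b φ) : coeffMap (Y := Y) e M = e ⟨M, hM⟩ := by
  unfold coeffMap
  rw [dif_pos hM]

omit [TopologicalSpace G] [IsTopologicalGroup G] in
/-- `coeffMap` is additive in `e`. [folklore] -/
theorem coeffMap_add (e e' : kerParabolic b φ →+ Y) (M : Matrix n n B) :
    coeffMap (Y := Y) (e + e') M = coeffMap (Y := Y) e M + coeffMap (Y := Y) e' M := by
  unfold coeffMap
  split_ifs with h
  · rfl
  · rw [add_zero]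

omit [TopologicalSpace G] [IsTopologicalGroup G] in
/-- `coeffMap` is homogeneous in `e`. [folklore] -/
theorem coeffMap_smul (r : R) (e : kerParabolic b φ →+ Y) (M : Matrix n n B) :
    coeffMap (Y := Y) (r • e) M = r • coeffMap (Y := Y) e M := by
  unfold coeffMap
  split_ifs with h
  · rfl
  · rw [smul_zero]

include hI hs hsP hρP hρ in
/-- **The defect cocycle with values in `Y`**: `(σ, τ) ↦ e(c(σ, τ))` is a continuous
inhomogeneous `2`-cocycle for every equivariant additive `e : 𝔭_b(I) → Y`.
[cite: Mazur1989Deforming, §1.6 Prop. 2] [cite: Bockle2007Presentations, Theorem 2.2] -/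
def defectCocycleIn (e : kerParabolic b φ →+ Y) (he : IsConjEquivariant b hsP ρ hρP Y e) :
    contTwoCocycles Y :=
  ⟨⟨fun p => coeffMap (Y := Y) e (liftDefect s ρ p.1 p.2),
    ((isLocallyConstant_liftDefect ρ hρ).comp (coeffMap (Y := Y) e)).continuous⟩,
    fun σ τ υ => by
      change Y.ρ σ (coeffMap (Y := Y) e (liftDefect s ρ τ υ)) +
          coeffMap (Y := Y) e (liftDefect s ρ σ (τ * υ)) =
        coeffMap (Y := Y) e (liftDefect s ρ (σ * τ) υ) + coeffMap (Y := Y) e (liftDefect s ρ σ τ)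
      rw [coeffMap_apply_of_mem e (liftDefect_mem_kerParabolic b hs hsP ρ hρP τ υ),
        coeffMap_apply_of_mem e (liftDefect_mem_kerParabolic b hs hsP ρ hρP σ (τ * υ)),
        coeffMap_apply_of_mem e (liftDefect_mem_kerParabolic b hs hsP ρ hρP (σ * τ) υ),
        coeffMap_apply_of_mem e (liftDefect_mem_kerParabolic b hs hsP ρ hρP σ τ),
        ← he σ, ← map_add, ← map_add, conjKerParabolic_defect_add b hI hs hsP ρ hρP σ τ υ]⟩

/-- Unfolding `defectCocycleIn`. [folklore] -/
@[simp] theorem defectCocycleIn_apply (e : kerParabolic b φ →+ Y)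
    (he : IsConjEquivariant b hsP ρ hρP Y e) (σ τ : G) :
    (defectCocycleIn hI hs hρ e he).1 (σ, τ) =
      e ⟨liftDefect s ρ σ τ, liftDefect_mem_kerParabolic b hs hsP ρ hρP σ τ⟩ :=
  coeffMap_apply_of_mem e _

/-- **Additivity in the coefficient map**: `(e + e') ∘ c = e ∘ c + e' ∘ c`.
[cite: Mazur1989Deforming, §1.6 Prop. 2] -/
theorem defectCocycleIn_add (e e' : kerParabolic b φ →+ Y)
    (he : IsConjEquivariant b hsP ρ hρP Y e) (he' : IsConjEquivariant b hsP ρ hρP Y e') :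
    defectCocycleIn hI hs hρ (e + e') (he.add he') =
      defectCocycleIn hI hs hρ e he + defectCocycleIn hI hs hρ e' he' := by
  refine Subtype.ext (ContinuousMap.ext fun p => ?_)
  exact coeffMap_add e e' _

/-- **Homogeneity in the coefficient map**: `(r • e) ∘ c = r • (e ∘ c)`. [folklore] -/
theorem defectCocycleIn_smul (r : R) (e : kerParabolic b φ →+ Y)
    (he : IsConjEquivariant b hsP ρ hρP Y e) :
    defectCocycleIn hI hs hρ (r • e) (he.smul r) =
      r • defectCocycleIn hI hs hρ e he := by
  refine Subtype.ext (ContinuousMap.ext fun p => ?_)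
  exact coeffMap_smul r e _

variable [LocallyCompactSpace G]

/-- **The obstruction class with coefficients in `Y`**: `[e ∘ c] ∈ H²_cont(G, Y)`.
[cite: Mazur1989Deforming, §1.6 Prop. 2] [cite: Bockle2007Presentations, Theorem 2.2] -/
def obstructionClassIn (e : kerParabolic b φ →+ Y) (he : IsConjEquivariant b hsP ρ hρP Y e) :
    continuousCohomology 2 Y :=
  twoCocycleClass Y (defectCocycleIn hI hs hρ e he)

/-- `obstructionClassIn` is additive in `e`. [cite: Mazur1989Deforming, §1.6 Prop. 2] -/
theorem obstructionClassIn_add (e e' : kerParabolic b φ →+ Y)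
    (he : IsConjEquivariant b hsP ρ hρP Y e) (he' : IsConjEquivariant b hsP ρ hρP Y e') :
    obstructionClassIn hI hs hρ (e + e') (he.add he') =
      obstructionClassIn hI hs hρ e he + obstructionClassIn hI hs hρ e' he' := by
  unfold obstructionClassIn
  rw [defectCocycleIn_add, twoCocycleClass_add]

/-- `obstructionClassIn` is homogeneous in `e`. [folklore] -/
theorem obstructionClassIn_smul (r : R) (e : kerParabolic b φ →+ Y)
    (he : IsConjEquivariant b hsP ρ hρP Y e) :
    obstructionClassIn hI hs hρ (r • e) (he.smul r) =
      r • obstructionClassIn hI hs hρ e he := by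
  unfold obstructionClassIn
  rw [defectCocycleIn_smul, twoCocycleClass_smul]

/-! ## 3. The criterion for an identification of coefficients -/

variable [DiscreteTopology Y]

/-- **Mazur's criterion with transported coefficients.**  If `e : 𝔭_b(I) → Y` is an equivariant
additive BIJECTION onto the discrete representation `Y`, then `[e ∘ c] = 0` in `H²_cont(G, Y)`
iff `ρ` lifts to a `P_b(B)`-valued homomorphism `G → GL_n(B)` with open kernel.
[cite: Mazur1989Deforming, §1.6 Prop. 2] [cite: Bockle2007Presentations, Theorem 2.2] -/
theorem obstructionClassIn_eq_zero_iff (e : kerParabolic b φ →+ Y)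
    (he : IsConjEquivariant b hsP ρ hρP Y e) (hbij : Function.Bijective e) :
    obstructionClassIn hI hs hρ e he = 0 ↔
      ∃ ρ' : G →* GL n B, IsOpen ((ρ'.ker : Subgroup G) : Set G) ∧
        (∀ σ, ρ' σ ∈ parabolicGL b B) ∧
        ∀ σ, Matrix.GeneralLinearGroup.map φ (ρ' σ) = ρ σ := by
  let E : kerParabolic b φ ≃+ Y := AddEquiv.ofBijective e hbij
  have hE : ∀ X, E X = e X := fun X => rfl
  unfold obstructionClassIn
  rw [twoCocycleClass_eq_zero_iff]
  constructor
  · rintro ⟨b', hb'⟩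
    -- the `𝔭_b(I)`-valued splitting cochain `c = E⁻¹ ∘ b'`
    set c : G → Matrix n n B := fun σ => ((E.symm (b' σ) : kerParabolic b φ) : Matrix n n B)
      with hcdef
    have hcmem : ∀ σ, c σ ∈ kerParabolic b φ := fun σ => (E.symm (b' σ)).2
    have hc' : ∀ σ τ, liftDefect s ρ σ τ =
        (s (ρ σ) : Matrix n n B) * c τ * ((s (ρ σ))⁻¹ : GL n B) - c (σ * τ) + c σ := by
      intro σ τ
      have h1 := hb' σ τ
      rw [defectCocycleIn_apply] at h1
      -- compare in `𝔭_b(I)` through the injection `E`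
      have k1 : E (conjKerParabolic b hsP ρ hρP σ (E.symm (b' τ))) = Y.ρ σ (b' τ) := by
        rw [hE, he σ, ← hE, E.apply_symm_apply]
      have h2 : E ⟨liftDefect s ρ σ τ, liftDefect_mem_kerParabolic b hs hsP ρ hρP σ τ⟩ =
          E (conjKerParabolic b hsP ρ hρP σ (E.symm (b' τ)) - E.symm (b' (σ * τ)) +
            E.symm (b' σ)) := by
        rw [map_add, map_sub, k1, E.apply_symm_apply, E.apply_symm_apply, hE]
        exact h1
      have h3 := E.injective h2
      exact congrArg (fun X : kerParabolic b φ => (X : Matrix n n B)) h3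
    refine ⟨liftOfCoboundary hs hI ρ c (fun σ => (hcmem σ).1) hc', ?_,
      liftOfCoboundary_mem_parabolicGL b hs hsP ρ hρP hI c hcmem hc',
      map_liftOfCoboundary hs hI ρ c _ hc'⟩
    -- open kernel: it contains `ker ρ ∩ {b' = b' 1}`, a neighbourhood of `1`
    refine Subgroup.isOpen_of_mem_nhds _ (g := 1) ?_
    have hU : ({σ : G | ρ σ = 1} ∩ {σ | b' σ = b' 1}) ∈ 𝓝 (1 : G) := by
      refine Filter.inter_mem (hρ.mem_nhds (by simp)) ?_
      exact ((isOpen_discrete {b' 1}).preimage b'.continuous).mem_nhds rfl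
    refine Filter.mem_of_superset hU ?_
    rintro σ ⟨hσ1, hσ2⟩
    rw [Set.mem_setOf_eq] at hσ1 hσ2
    have hcσ : c σ = c 1 := by
      simp only [hcdef, hσ2]
    have key : liftOfCoboundary hs hI ρ c (fun σ => (hcmem σ).1) hc' σ =
        liftOfCoboundary hs hI ρ c (fun σ => (hcmem σ).1) hc' 1 := by
      rw [liftOfCoboundary_apply, liftOfCoboundary_apply]
      have e1 : unitOfKer hI (-c σ) (neg_mem (hcmem σ).1) =
          unitOfKer hI (-c 1) (neg_mem (hcmem 1).1) :=
        Units.ext (by simp [hcσ])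
      rw [e1, hσ1, ρ.map_one]
    rw [SetLike.mem_coe, MonoidHom.mem_ker, key, MonoidHom.map_one]
  · rintro ⟨ρ', hρ'open, hρ'P, hρ'⟩
    obtain ⟨-, hcob⟩ := liftDefect_eq_of_lift hs hI ρ ρ' hρ'
    have hmem := splitting_mem_kerParabolic b hs hsP ρ hρP ρ' hρ'P hρ'
    -- the splitting cochain, transported to `Y`
    set d : G → Matrix n n B := fun σ => -(((ρ' σ * (s (ρ σ))⁻¹ : GL n B) : Matrix n n B) - 1)
      with hddef
    have hlc : IsLocallyConstant d := by
      have h1 : IsLocallyConstant fun σ : G => (ρ' σ, ρ σ) :=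
        (isLocallyConstant_of_isOpen_ker' ρ' hρ'open).prodMk
          (isLocallyConstant_of_isOpen_ker' ρ hρ)
      exact h1.comp fun q : GL n B × GL n A => -(((q.1 * (s q.2)⁻¹ : GL n B) : Matrix n n B) - 1)
    refine ⟨⟨fun σ => coeffMap (Y := Y) e (d σ), (hlc.comp (coeffMap (Y := Y) e)).continuous⟩,
      fun σ τ => ?_⟩
    change coeffMap (Y := Y) e (liftDefect s ρ σ τ) =
      Y.ρ σ (coeffMap (Y := Y) e (d τ)) - coeffMap (Y := Y) e (d (σ * τ)) + coeffMap (Y := Y) e (d σ)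
    rw [coeffMap_apply_of_mem e (liftDefect_mem_kerParabolic b hs hsP ρ hρP σ τ),
      coeffMap_apply_of_mem e (hmem τ), coeffMap_apply_of_mem e (hmem (σ * τ)),
      coeffMap_apply_of_mem e (hmem σ), ← he σ, ← map_sub, ← map_add]
    congr 1
    exact Subtype.ext (hcob σ τ)

end Coefficients

end LiftingObstruction

end Literature.NumberTheory.GaloisRepresentations
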